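import Literature.NumberTheory.Sieve.PolynomialCongruencesRootDensity
import Literature.NumberTheory.LFunctions.HallTenenbaumTheorem01
import HarnessLib

/-!
# Mean values of the root count `ρ_f`: Hooley's `Σ₂`, `Σ₅` and the final Euler product

Topic `Literature/NumberTheory/Sieve`.  Fourth layer of the decomposition of the named fact
`Literature.NumberTheory.Sieve.hooley_polyRoots_logPowerSaving` (`PolynomialCongruences.lean`; Hooley 1964 as printed in
Dartyge–Martin 2019, Lemma 5).  Everything is PROVED (no `sorry`).

For `f ∈ ℤ[X]` irreducible of degree `n` (`ρ_f(m) = polyRootCountMod ![f] m`), the assembly of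
Hooley's bound `∑_{k ≤ x} |S_f(h,k)| ≪ x (log log x)^{(n²+1)/2} (log x)^{−δ_n}` (Martin–Sitar 2011,
§3.2: `R_f(h,x) = Σ₁ + Σ₂`, `Σ₁ ≪ ∑_{k₁ ≤ x^{1/3}} √(Σ₅ Σ₆)`, `Σ₂ ≪ ∑_{k ≤ x, k₁ > x^{1/3}} ρ(k)`)
consumes three mean-value estimates for `ρ_f`, all obtained here from Hall–Tenenbaum's Theorem 01
and inequality (0.4) (`HallTenenbaumTheorem01.lean`, PROVED in the tree), extended first to
nonnegative multiplicative functions bounded by a constant `K` at the prime powers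
(`HallTenenbaum.sum_le_of_le`, `HallTenenbaum.sum_div_le_exp_of_le`):

* `exists_sum_sq_rootCount_rough_le` — **`Σ₅`**: for `2 ≤ X ≤ y`,
  `∑_{m ≤ y, p ∣ m ⇒ p > X} ρ_f(m)² ≤ C (y/log y) (log y/log X)^{n²}` (`ρ_f(p)² ≤ n²` and Mertens'
  `∑_{X < p ≤ y} 1/p ≤ log(log y/log X) + 16/log X`, `sum_inv_primes_Ioc_le`);
* `exists_sum_rootCount_le` — `∑_{m ≤ y} ρ_f(m) ≤ C y` (the inner sum of `Σ₂`);
* `exists_sum_rootCount_smooth_rpow_le` — **Rankin's trick** for the `X`-smooth numbers weighted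
  by `ρ_f` (Hooley's Lemma 7 / `Σ₂`): `∑_{k ≤ N, p ∣ k ⇒ p ≤ X} ρ_f(k) k^{t/log X − 1} ≤ C_t (log X)^A`
  for `3t ≤ log X`, via the Euler product over `p ≤ X` and the convexity bound
  `p^{t/log X} ≤ 1 + (e^t − 1) log p/log X` (`rpow_div_log_le`, `sum_primesLE_rpow_div_le`);
* `exists_sum_sqrt_gcd_rootCount_div_le` — the **final Euler product of `Σ₁`**:
  `∑_{k ≤ N} ((h,k) ρ_f(k)/(k φ(k)))^{1/2} ≤ C (log N)^{1 − δ_n}` for `n ≥ 2`, `h ≠ 0`, from the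
  density bound `∑_{p ≤ N} √ρ_f(p)/p ≤ (1 − δ_n) log log N + C` of
  `PolynomialCongruencesRootDensity.lean` (this is where Hooley's exponent `δ_n = (n − √n)/n!` enters).

Constants are existential and depend on `f` (and `h`, `t`); no uniformity beyond what the
assembly needs is claimed.

## References

* C. Hooley, *On the distribution of the roots of polynomial congruences*, Mathematika 11 (1964),
  39–49, Lemmas 4 and 7 and the estimation of `Σ₂`, `Σ₅`, `Σ₁` (not held; architecture and
  numbering as reported by the next two items). [cite: Hooley1964, Lemmas 4, 7]
* G. Martin, S. Sitar, *Erdős–Turán with a moving target, equidistribution of roots of reducible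
  quadratics, and Diophantine quadruples*, Mathematika 57 (2011), 1–29, §3.2 "Outline of proof"
  (`Σ₁`, `Σ₂`, `Σ₅`, `Σ₆`, and the last display `Σ₁ ≪ x (log log x)^{(N+1)/2}/log x · ∑ (…)^{1/2}`).
  [cite: MartinSitar2010, §3.2]
* S. Zehavi, arXiv:2003.13100 (2020), §3.2 (Lemma 3.4 "[5, Lemma 4]", the sums `Σ₂`, `θ(y, n₁)`).
  [cite: Zehavi2020, §3.2]
* R. R. Hall, G. Tenenbaum, *Divisors*, CUP 1988, Theorem 01 and (0.4). [cite: HallTenenbaum1988, Theorem 01]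

## Mathlib

Used: `convexOn_exp`, `Real.rpow_def_of_pos`, `Real.exp_nat_mul`, `summable_geometric_of_lt_one`,
`tsum_geometric_of_lt_one`, `Nat.Coprime.primeFactors_mul`, `Nat.primeFactors_prime_pow`,
`Nat.Coprime.gcd_mul`, `Nat.totient_mul`, `Nat.totient_prime_pow_succ`.
-/

noncomputable section

open Finset Real Polynomial
open scoped Nat

namespace Literature.NumberTheory.Sieve

/-! ### Hall–Tenenbaum's Theorem 01 for functions bounded at the prime powers -/

namespace HallTenenbaum

variable {f : ℕ → ℝ}

/-- Hypothesis (0.5) with `A = K log 4` when `f(p) ≤ K` at the primes (`K > 0`): reduce to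
`hypA_of_le_one` for `min(f/K, 1)`. [folklore] -/
theorem hypA_of_le {K : ℝ} (hK : 0 < K) (hfK : ∀ p : ℕ, p.Prime → f p ≤ K) {y : ℝ} (hy : 0 ≤ y) :
    ∑ p ∈ Nat.primesLE ⌊y⌋₊, f p * Real.log p ≤ K * Real.log 4 * y := by
  set g : ℕ → ℝ := fun n => min (f n / K) 1 with hg
  have hg1 : ∀ n, g n ≤ 1 := fun n => min_le_right _ _
  have hfg : ∀ p : ℕ, p.Prime → f p = K * g p := fun p hp => by
    have : g p = f p / K := min_eq_left ((div_le_one hK).2 (hfK p hp))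
    rw [this]; field_simp
  calc ∑ p ∈ Nat.primesLE ⌊y⌋₊, f p * Real.log p
      = K * ∑ p ∈ Nat.primesLE ⌊y⌋₊, g p * Real.log p := by
        rw [Finset.mul_sum]
        refine Finset.sum_congr rfl fun p hp => ?_
        rw [hfg p (Nat.prime_of_mem_primesLE hp)]; ring
    _ ≤ K * (Real.log 4 * y) := mul_le_mul_of_nonneg_left (LFunctions.HallTenenbaum.hypA_of_le_one hg1 hy) hK.le
    _ = K * Real.log 4 * y := by ring

/-- Hypothesis (0.6) with `B = K B₁` when `f(p^ν) ≤ K` at the prime powers (`K > 0`). [folklore] -/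
theorem hypB_of_le {K : ℝ} (hK : 0 < K) (hfK : ∀ p : ℕ, p.Prime → ∀ ν : ℕ, 1 ≤ ν → f (p ^ ν) ≤ K)
    (Y : ℕ) :
    ∑ p ∈ Nat.primesLE Y, ∑ ν ∈ Icc 2 Y, f (p ^ ν) / p ^ ν * Real.log (p ^ ν) ≤ K * LFunctions.HallTenenbaum.B₁ := by
  set g : ℕ → ℝ := fun n => min (f n / K) 1 with hg
  have hg1 : ∀ n, g n ≤ 1 := fun n => min_le_right _ _
  have hfg : ∀ p : ℕ, p.Prime → ∀ ν : ℕ, 1 ≤ ν → f (p ^ ν) = K * g (p ^ ν) := fun p hp ν hν => by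
    have : g (p ^ ν) = f (p ^ ν) / K := min_eq_left ((div_le_one hK).2 (hfK p hp ν hν))
    rw [this]; field_simp
  calc ∑ p ∈ Nat.primesLE Y, ∑ ν ∈ Icc 2 Y, f (p ^ ν) / p ^ ν * Real.log (p ^ ν)
      = K * ∑ p ∈ Nat.primesLE Y, ∑ ν ∈ Icc 2 Y, g (p ^ ν) / p ^ ν * Real.log (p ^ ν) := by
        rw [Finset.mul_sum]
        refine Finset.sum_congr rfl fun p hp => ?_
        rw [Finset.mul_sum]
        refine Finset.sum_congr rfl fun ν hν => ?_
        rw [hfg p (Nat.prime_of_mem_primesLE hp) ν (by have := (Finset.mem_Icc.1 hν).1; omega)]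
        ring
    _ ≤ K * LFunctions.HallTenenbaum.B₁ := mul_le_mul_of_nonneg_left (LFunctions.HallTenenbaum.hypB_of_le_one hg1 Y) hK.le

/-- The local factor when `f(p^ν) ≤ K` (`K ≥ 1`): `∑_ν f(p^ν)/p^ν` is summable and at most
`1 + f(p)/p + K/(p(p-1))`. [folklore] -/
theorem tsum_prime_pow_div_le_of_le (hf1 : f 1 = 1) (hf0 : ∀ n, 0 ≤ f n) {K : ℝ} (hK : 1 ≤ K)
    (hfK : ∀ p : ℕ, p.Prime → ∀ ν : ℕ, 1 ≤ ν → f (p ^ ν) ≤ K) {p : ℕ} (hp : p.Prime) :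
    Summable (fun ν : ℕ => f (p ^ ν) / (p : ℝ) ^ ν) ∧
      ∑' ν : ℕ, f (p ^ ν) / (p : ℝ) ^ ν ≤ 1 + f p / p + K / ((p : ℝ) * (p - 1)) := by
  have hp2 : (2 : ℝ) ≤ p := by exact_mod_cast hp.two_le
  have hp0 : (0 : ℝ) < p := by linarith
  set r : ℝ := 1 / p with hr
  have hr0 : 0 ≤ r := by positivity
  have hr1 : r < 1 := by rw [hr, div_lt_one hp0]; linarith
  have hle : ∀ ν, f (p ^ ν) / (p : ℝ) ^ ν ≤ K * r ^ ν := by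
    intro ν
    rcases Nat.eq_zero_or_pos ν with rfl | hν
    · simp [hf1]; exact hK
    · rw [hr, div_pow, one_pow, mul_one_div]
      exact div_le_div_of_nonneg_right (hfK p hp ν hν) (by positivity)
  have hnn : ∀ ν, 0 ≤ f (p ^ ν) / (p : ℝ) ^ ν := fun ν => div_nonneg (hf0 _) (by positivity)
  have hgeom : Summable (fun ν : ℕ => r ^ ν) := summable_geometric_of_lt_one hr0 hr1
  have hsum : Summable (fun ν : ℕ => f (p ^ ν) / (p : ℝ) ^ ν) :=
    Summable.of_nonneg_of_le hnn hle (hgeom.mul_left K)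
  refine ⟨hsum, ?_⟩
  rw [hsum.tsum_eq_zero_add, ((summable_nat_add_iff 1).mpr hsum).tsum_eq_zero_add]
  simp only [pow_zero, hf1, div_one, zero_add, pow_one]
  have h2 : ∑' ν : ℕ, f (p ^ (ν + 1 + 1)) / (p : ℝ) ^ (ν + 1 + 1) ≤ K * r ^ 2 * (1 - r)⁻¹ := by
    have hle2 : ∀ ν : ℕ, f (p ^ (ν + 1 + 1)) / (p : ℝ) ^ (ν + 1 + 1) ≤ K * r ^ 2 * r ^ ν := by
      intro ν
      calc _ ≤ K * r ^ (ν + 1 + 1) := hle _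
        _ = K * r ^ 2 * r ^ ν := by ring
    calc _ ≤ ∑' ν : ℕ, K * r ^ 2 * r ^ ν :=
          ((summable_nat_add_iff 2).mpr hsum).tsum_le_tsum hle2 (hgeom.mul_left _)
      _ = K * r ^ 2 * (1 - r)⁻¹ := by rw [tsum_mul_left, tsum_geometric_of_lt_one hr0 hr1]
  have h3 : r ^ 2 * (1 - r)⁻¹ = 1 / ((p : ℝ) * (p - 1)) := by
    have hp1 : (p : ℝ) - 1 ≠ 0 := by linarith
    have e1 : (1 : ℝ) - r = (p - 1) / p := by rw [hr]; field_simp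
    rw [e1, inv_div, hr, div_pow, one_pow, div_mul_div_comm, one_mul, pow_two]
    field_simp
  have h4 : K * r ^ 2 * (1 - r)⁻¹ = K / ((p : ℝ) * (p - 1)) := by
    rw [mul_assoc, h3]; ring
  linarith [h2, h4.le, h4.ge]

/-- **(0.4) for `f(p^ν) ≤ K`**: `∑_{n ≤ X} f(n)/n ≤ exp(K + ∑_{p ≤ X} f(p)/p)`.
[cite: HallTenenbaum1988, (0.4)] -/
theorem sum_div_le_exp_of_le (hf1 : f 1 = 1)
    (hmul : ∀ m n, Nat.Coprime m n → f (m * n) = f m * f n) (hf0 : ∀ n, 0 ≤ f n) {K : ℝ}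
    (hK : 1 ≤ K) (hfK : ∀ p : ℕ, p.Prime → ∀ ν : ℕ, 1 ≤ ν → f (p ^ ν) ≤ K) (X : ℕ) :
    ∑ n ∈ Icc 1 X, f n / n ≤ Real.exp (K + ∑ p ∈ Nat.primesLE X, f p / p) := by
  have h1 := LFunctions.HallTenenbaum.sum_div_le_prod_tsum hf1 hmul hf0
    (fun p hp => (tsum_prime_pow_div_le_of_le hf1 hf0 hK hfK hp).1) X
  refine h1.trans ?_
  have h2 : ∏ p ∈ Nat.primesLE X, ∑' ν : ℕ, f (p ^ ν) / (p : ℝ) ^ ν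
      ≤ ∏ p ∈ Nat.primesLE X, Real.exp (f p / p + K * (1 / ((p : ℝ) * (p - 1)))) := by
    refine Finset.prod_le_prod (fun p _ => tsum_nonneg fun ν => div_nonneg (hf0 _) (by positivity))
      fun p hp => ?_
    have hp' := Nat.prime_of_mem_primesLE hp
    refine (tsum_prime_pow_div_le_of_le hf1 hf0 hK hfK hp').2.trans ?_
    have : K / ((p : ℝ) * (p - 1)) = K * (1 / ((p : ℝ) * (p - 1))) := by ring
    rw [this]
    linarith [Real.add_one_le_exp (f p / p + K * (1 / ((p : ℝ) * (p - 1))))]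
  refine h2.trans ?_
  rw [← Real.exp_sum, Real.exp_le_exp, Finset.sum_add_distrib, ← Finset.mul_sum]
  have h3 := LFunctions.HallTenenbaum.sum_primesLE_inv_mul_pred_le_one X
  have hK0 : 0 ≤ K := by linarith
  nlinarith [mul_le_mul_of_nonneg_left h3 hK0]

/-- **Theorem 01 + (0.4) for `f(p^ν) ≤ K`, packaged**: for `x > 1`,
`∑_{n ≤ x} f(n) ≤ (K log 4 + K B₁ + 1) (x / log x) exp(K + ∑_{p ≤ x} f(p)/p)`.
[cite: HallTenenbaum1988, Theorem 01 and (0.4)] -/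
theorem sum_le_of_le (hf1 : f 1 = 1)
    (hmul : ∀ m n, Nat.Coprime m n → f (m * n) = f m * f n) (hf0 : ∀ n, 0 ≤ f n) {K : ℝ}
    (hK : 1 ≤ K) (hfK : ∀ p : ℕ, p.Prime → ∀ ν : ℕ, 1 ≤ ν → f (p ^ ν) ≤ K) {x : ℝ} (hx : 1 < x) :
    ∑ n ∈ Icc 1 ⌊x⌋₊, f n
      ≤ (K * Real.log 4 + K * LFunctions.HallTenenbaum.B₁ + 1) * (x / Real.log x)
          * Real.exp (K + ∑ p ∈ Nat.primesLE ⌊x⌋₊, f p / p) := by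
  have hK0 : 0 < K := by linarith
  have hA : ∀ y : ℝ, 0 ≤ y → ∑ p ∈ Nat.primesLE ⌊y⌋₊, f p * Real.log p ≤ K * Real.log 4 * y :=
    fun y hy => hypA_of_le hK0 (fun p hp => by simpa using hfK p hp 1 le_rfl) hy
  have hB := hypB_of_le hK0 hfK (f := f)
  refine (LFunctions.HallTenenbaum.theorem01 hf1 hmul hf0 hA hB hx).trans ?_
  have hlog4 : 0 ≤ Real.log 4 := Real.log_nonneg (by norm_num)
  have hc : 0 ≤ (K * Real.log 4 + K * LFunctions.HallTenenbaum.B₁ + 1) * (x / Real.log x) := by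
    have := LFunctions.HallTenenbaum.B₁_nonneg
    have hx0 : 0 ≤ x / Real.log x := div_nonneg (by linarith) (Real.log_nonneg hx.le)
    positivity
  exact mul_le_mul_of_nonneg_left (sum_div_le_exp_of_le hf1 hmul hf0 hK hfK ⌊x⌋₊) hc

end HallTenenbaum

/-! ### Elementary facts about `ρ_f` used by all three mean values

(The evaluations `ρ_f(1) = 1`, `ρ_f(0) = 0` are obtained in place from `polyRootCountMod_single`;
as named lemmas they are `polyRootCountMod_one` / `polyRootCountMod_zero` of the tree's
`PolynomialCongruencesProofs.lean`, which this file does not import.) -/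

section RootCount

variable {f : ℤ[X]}

/-- **Hooley's Lemma 4, prime-power form**: for `f` irreducible of positive degree `n` there is
`M ≥ 1` with `ρ_f(p^a) ≤ n M` for every prime `p` and every `a ≥ 1`, and `ρ_f(p) ≤ n` for every
prime `p` (the tree's `exists_polyRootCountMod_prime_pow_le` and Lagrange). [cite: Hooley1964,
Lemma 4 (per MartinSitar2010 §3.2)] -/
theorem exists_rootCount_primePow_le (hirr : Irreducible f) (hdeg : 0 < f.natDegree) :
    ∃ M : ℕ, 1 ≤ M ∧ (∀ p : ℕ, p.Prime → ∀ a : ℕ, polyRootCountMod ![f] (p ^ a) ≤ f.natDegree * M) ∧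
      ∀ p : ℕ, p.Prime → polyRootCountMod ![f] p ≤ f.natDegree := by
  obtain ⟨M, hM1, hM⟩ := exists_polyRootCountMod_prime_pow_le hirr hdeg
  exact ⟨M, hM1, hM, fun p hp => polyRootCountMod_prime_le_natDegree_of_irreducible hirr hdeg hp⟩

end RootCount

/-! ### Mertens over an interval of primes -/

/-- `∑_{X < p ≤ y} 1/p ≤ log log y − log log X + 16/log X` for `2 ≤ X ≤ y` (two applications of
`Mertens.abs_primeRecipSum_sub_le`). [folklore] -/
theorem sum_inv_primes_Ioc_le {X y : ℝ} (hX : 2 ≤ X) (hXy : X ≤ y) :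
    ∑ p ∈ (Nat.primesLE ⌊y⌋₊).filter (fun p : ℕ => X < (p : ℝ)), (p : ℝ)⁻¹ ≤
      Real.log (Real.log y) - Real.log (Real.log X) + 16 / Real.log X := by
  have hy : 2 ≤ y := hX.trans hXy
  have h1 := LFunctions.Mertens.abs_primeRecipSum_sub_le hy
  have h2 := LFunctions.Mertens.abs_primeRecipSum_sub_le hX
  have hsub : Nat.primesLE ⌊X⌋₊ ⊆ Nat.primesLE ⌊y⌋₊ := Nat.primesLE_mono (Nat.floor_mono hXy)
  have hfilter : (Nat.primesLE ⌊y⌋₊).filter (fun p : ℕ => X < (p : ℝ)) =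
      Nat.primesLE ⌊y⌋₊ \ Nat.primesLE ⌊X⌋₊ := by
    ext p
    simp only [Finset.mem_filter, Finset.mem_sdiff, Nat.mem_primesLE]
    constructor
    · rintro ⟨⟨hpy, hp⟩, hXp⟩
      refine ⟨⟨hpy, hp⟩, fun h => ?_⟩
      have : (p : ℝ) ≤ X := (Nat.le_floor_iff (by linarith)).1 h.1
      linarith
    · rintro ⟨⟨hpy, hp⟩, h⟩
      refine ⟨⟨hpy, hp⟩, ?_⟩
      by_contra hle
      exact h ⟨Nat.le_floor (not_lt.1 hle), hp⟩
  rw [hfilter, Finset.sum_sdiff_eq_sub hsub]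
  have e1 : ∑ p ∈ Nat.primesLE ⌊y⌋₊, (p : ℝ)⁻¹ = LFunctions.Mertens.primeRecipSum y := rfl
  have e2 : ∑ p ∈ Nat.primesLE ⌊X⌋₊, (p : ℝ)⁻¹ = LFunctions.Mertens.primeRecipSum X := rfl
  rw [e1, e2]
  have hlogX : 0 < Real.log X := Real.log_pos (by linarith)
  have hlogy : Real.log X ≤ Real.log y := Real.log_le_log (by linarith) hXy
  have h3 : 8 / Real.log y ≤ 8 / Real.log X := div_le_div_of_nonneg_left (by norm_num) hlogX hlogy
  rw [abs_le] at h1 h2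
  have : (16 : ℝ) / Real.log X = 8 / Real.log X + 8 / Real.log X := by ring
  linarith [h1.2, h2.1]

/-- `log log y − log log X = log (log y / log X) ≤ log y / log X − 1`-free form used below:
`exp (c (log log y − log log X)) = (log y / log X)^c`. [folklore] -/
theorem exp_mul_loglog_sub_loglog {X y : ℝ} (hX : 1 < X) (hXy : X ≤ y) (c : ℕ) :
    Real.exp (c * (Real.log (Real.log y) - Real.log (Real.log X))) =
      (Real.log y / Real.log X) ^ c := by
  have hlogX : 0 < Real.log X := Real.log_pos hX
  have hlogy : 0 < Real.log y := Real.log_pos (by linarith)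
  rw [← Real.log_div hlogy.ne' hlogX.ne', Real.exp_nat_mul, Real.exp_log (div_pos hlogy hlogX)]

/-! ### `Σ₅`: the second moment of `ρ_f` over the rough numbers -/

/-- **Hooley's `Σ₅`** (Martin–Sitar 2011, §3.2: "`Σ₅` … estimates for `ρ_f`"; Zehavi 2020, §3.2):
for `f` irreducible of degree `n ≥ 1` there is `C = C(f)` such that for `2 ≤ X ≤ y`,
`∑_{m ≤ y, p ∣ m ⇒ p > X} ρ_f(m)² ≤ C (y / log y) (log y / log X)^{n²}`.
Proof: Hall–Tenenbaum's Theorem 01 with (0.4) for the multiplicative function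
`ρ_f² · 1_{X-rough}` (bounded by `(nM)²` at prime powers), `ρ_f(p)² ≤ n²` and
`∑_{X < p ≤ y} 1/p ≤ log(log y/log X) + O(1)`. [cite: MartinSitar2010, §3.2 (the sum Σ₅ of Hooley's proof)] -/
theorem exists_sum_sq_rootCount_rough_le {f : ℤ[X]} (hirr : Irreducible f) (hdeg : 0 < f.natDegree) :
    ∃ C : ℝ, 0 < C ∧ ∀ X y : ℝ, 2 ≤ X → X ≤ y →
      ∑ m ∈ (Icc 1 ⌊y⌋₊).filter (fun m : ℕ => ∀ p ∈ m.primeFactors, X < (p : ℝ)),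
        ((polyRootCountMod ![f] m : ℝ)) ^ 2 ≤
          C * (y / Real.log y) * (Real.log y / Real.log X) ^ (f.natDegree ^ 2) := by
  obtain ⟨M, hM1, hM, hρp⟩ := exists_rootCount_primePow_le hirr hdeg
  set n := f.natDegree with hn
  set K : ℝ := ((n * M : ℕ) : ℝ) ^ 2 with hK
  have hnM1 : (1 : ℝ) ≤ ((n * M : ℕ) : ℝ) := by exact_mod_cast Nat.mul_le_mul hdeg hM1
  have hK1 : 1 ≤ K := by rw [hK]; nlinarith
  set C₁ : ℝ := K * Real.log 4 + K * LFunctions.HallTenenbaum.B₁ + 1 with hC₁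
  have hC₁0 : 0 < C₁ := by
    have := LFunctions.HallTenenbaum.B₁_nonneg
    have : 0 ≤ Real.log 4 := Real.log_nonneg (by norm_num)
    positivity
  refine ⟨C₁ * Real.exp (K + (n : ℝ) ^ 2 * (16 / Real.log 2)), by positivity,
    fun X y hX hXy => ?_⟩
  have hy : 2 ≤ y := hX.trans hXy
  have hy1 : 1 < y := by linarith
  -- the multiplicative function `F = ρ² · 1_{rough}`
  set ρ : ℕ → ℝ := fun m => (polyRootCountMod ![f] m : ℝ) with hρ
  set F : ℕ → ℝ := fun m => if ∀ p ∈ m.primeFactors, X < (p : ℝ) then ρ m ^ 2 else 0 with hF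
  have hF1 : F 1 = 1 := by simp [hF, hρ, (show polyRootCountMod ![f] 1 = 1 by rw [polyRootCountMod_single]; simp)]
  have hF0 : ∀ m, 0 ≤ F m := fun m => by
    simp only [hF]; split_ifs <;> positivity
  have hFmul : ∀ a b, Nat.Coprime a b → F (a * b) = F a * F b := by
    intro a b hab
    have hiff : (∀ p ∈ (a * b).primeFactors, X < (p : ℝ)) ↔
        (∀ p ∈ a.primeFactors, X < (p : ℝ)) ∧ ∀ p ∈ b.primeFactors, X < (p : ℝ) := by
      rw [Nat.Coprime.primeFactors_mul hab, Finset.forall_mem_union]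
    simp only [hF]
    by_cases ha : ∀ p ∈ a.primeFactors, X < (p : ℝ)
    · by_cases hb : ∀ p ∈ b.primeFactors, X < (p : ℝ)
      · rw [if_pos (hiff.2 ⟨ha, hb⟩), if_pos ha, if_pos hb, hρ]
        dsimp only
        rw [polyRootCountMod_mul_of_coprime f hab, Nat.cast_mul, mul_pow]
      · rw [if_neg (fun h => hb (hiff.1 h).2), if_neg hb, mul_zero]
    · rw [if_neg (fun h => ha (hiff.1 h).1), if_neg ha, zero_mul]
  have hFK : ∀ p : ℕ, p.Prime → ∀ ν : ℕ, 1 ≤ ν → F (p ^ ν) ≤ K := by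
    intro p hp ν _
    simp only [hF]
    split_ifs
    · rw [hK]
      have : ρ (p ^ ν) ≤ ((n * M : ℕ) : ℝ) := by simp only [hρ]; exact_mod_cast hM p hp ν
      exact pow_le_pow_left₀ (Nat.cast_nonneg _) this 2
    · positivity
  -- Hall–Tenenbaum
  have hHT := HallTenenbaum.sum_le_of_le hF1 hFmul hF0 hK1 hFK hy1
  -- the left side is `∑ F`
  have hLHS : ∑ m ∈ (Icc 1 ⌊y⌋₊).filter (fun m : ℕ => ∀ p ∈ m.primeFactors, X < (p : ℝ)), ρ m ^ 2 =
      ∑ m ∈ Icc 1 ⌊y⌋₊, F m := by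
    rw [Finset.sum_filter]
  -- the prime sum `∑_{p ≤ y} F(p)/p ≤ n² ∑_{X < p ≤ y} 1/p`
  have hprime : ∑ p ∈ Nat.primesLE ⌊y⌋₊, F p / p ≤
      (n : ℝ) ^ 2 * ∑ p ∈ (Nat.primesLE ⌊y⌋₊).filter (fun p : ℕ => X < (p : ℝ)), (p : ℝ)⁻¹ := by
    rw [Finset.mul_sum, Finset.sum_filter]
    refine Finset.sum_le_sum fun p hp => ?_
    have hp' := Nat.prime_of_mem_primesLE hp
    have hp0 : (0 : ℝ) < p := by exact_mod_cast hp'.pos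
    simp only [hF, hp'.primeFactors, Finset.mem_singleton, forall_eq]
    split_ifs with hXp
    · rw [div_eq_mul_inv]
      refine mul_le_mul_of_nonneg_right ?_ (inv_nonneg.2 hp0.le)
      have : ρ p ≤ n := by simp only [hρ]; exact_mod_cast hρp p hp'
      exact pow_le_pow_left₀ (Nat.cast_nonneg _) this 2
    · simp
  have hmert := sum_inv_primes_Ioc_le hX hXy
  have hlog2 : 0 < Real.log 2 := Real.log_pos (by norm_num)
  have hlogX : Real.log 2 ≤ Real.log X := Real.log_le_log (by norm_num) hX
  have h16 : 16 / Real.log X ≤ 16 / Real.log 2 := div_le_div_of_nonneg_left (by norm_num) hlog2 hlogX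
  have hexp : Real.exp (K + ∑ p ∈ Nat.primesLE ⌊y⌋₊, F p / p) ≤
      Real.exp (K + (n : ℝ) ^ 2 * (16 / Real.log 2)) * (Real.log y / Real.log X) ^ (n ^ 2) := by
    rw [← exp_mul_loglog_sub_loglog (by linarith) hXy, ← Real.exp_add, Real.exp_le_exp]
    have hn2 : (0 : ℝ) ≤ (n : ℝ) ^ 2 := by positivity
    have := mul_le_mul_of_nonneg_left (hmert.trans (by linarith [h16] :
      Real.log (Real.log y) - Real.log (Real.log X) + 16 / Real.log X ≤
        Real.log (Real.log y) - Real.log (Real.log X) + 16 / Real.log 2)) hn2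
    push_cast
    nlinarith [hprime, this]
  have hylog : 0 ≤ y / Real.log y := div_nonneg (by linarith) (Real.log_nonneg hy1.le)
  calc ∑ m ∈ (Icc 1 ⌊y⌋₊).filter (fun m : ℕ => ∀ p ∈ m.primeFactors, X < (p : ℝ)), ρ m ^ 2
      = ∑ m ∈ Icc 1 ⌊y⌋₊, F m := hLHS
    _ ≤ C₁ * (y / Real.log y) * Real.exp (K + ∑ p ∈ Nat.primesLE ⌊y⌋₊, F p / p) := hHT
    _ ≤ C₁ * (y / Real.log y) *
          (Real.exp (K + (n : ℝ) ^ 2 * (16 / Real.log 2)) * (Real.log y / Real.log X) ^ (n ^ 2)) :=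
        mul_le_mul_of_nonneg_left hexp (by positivity)
    _ = C₁ * Real.exp (K + (n : ℝ) ^ 2 * (16 / Real.log 2)) * (y / Real.log y) *
          (Real.log y / Real.log X) ^ (n ^ 2) := by ring

/-! ### The first moment of `ρ_f` -/

/-- **`∑_{m ≤ y} ρ_f(m) ≤ C y`** for `f` irreducible of positive degree and `y ≥ 2`
(Hall–Tenenbaum's Theorem 01 with (0.4) for `ρ_f`, bounded by `nM` at prime powers, and the
Mertens bound `∑_{p ≤ y} ρ_f(p)/p ≤ log log y + C_f` of `PolynomialCongruencesLemmas.lean`).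
[folklore] -/
theorem exists_sum_rootCount_le {f : ℤ[X]} (hirr : Irreducible f) (hdeg : 0 < f.natDegree) :
    ∃ C : ℝ, 0 < C ∧ ∀ y : ℝ, 2 ≤ y →
      ∑ m ∈ Icc 1 ⌊y⌋₊, (polyRootCountMod ![f] m : ℝ) ≤ C * y := by
  obtain ⟨M, hM1, hM, -⟩ := exists_rootCount_primePow_le hirr hdeg
  obtain ⟨Cf, hCf⟩ := exists_sum_primesLE_rootCount_div_le hirr hdeg
  set n := f.natDegree with hn
  set K : ℝ := ((n * M : ℕ) : ℝ) with hK
  have hK1 : (1 : ℝ) ≤ K := by rw [hK]; exact_mod_cast Nat.mul_le_mul hdeg hM1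
  set C₁ : ℝ := K * Real.log 4 + K * LFunctions.HallTenenbaum.B₁ + 1 with hC₁
  have hC₁0 : 0 < C₁ := by
    have := LFunctions.HallTenenbaum.B₁_nonneg
    have : 0 ≤ Real.log 4 := Real.log_nonneg (by norm_num)
    positivity
  refine ⟨C₁ * Real.exp (K + Cf), by positivity, fun y hy => ?_⟩
  have hy1 : 1 < y := by linarith
  set ρ : ℕ → ℝ := fun m => (polyRootCountMod ![f] m : ℝ) with hρ
  have hρ1 : ρ 1 = 1 := by simp [hρ, (show polyRootCountMod ![f] 1 = 1 by rw [polyRootCountMod_single]; simp)]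
  have hρ0 : ∀ m, 0 ≤ ρ m := fun m => Nat.cast_nonneg _
  have hρmul : ∀ a b, Nat.Coprime a b → ρ (a * b) = ρ a * ρ b := fun a b hab => by
    simp only [hρ, polyRootCountMod_mul_of_coprime f hab, Nat.cast_mul]
  have hρK : ∀ p : ℕ, p.Prime → ∀ ν : ℕ, 1 ≤ ν → ρ (p ^ ν) ≤ K := fun p hp ν _ => by
    simp only [hρ, hK]; exact_mod_cast hM p hp ν
  have hHT := HallTenenbaum.sum_le_of_le hρ1 hρmul hρ0 hK1 hρK hy1
  have hfl2 : 2 ≤ ⌊y⌋₊ := Nat.le_floor (by simpa using hy)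
  have hprime : ∑ p ∈ Nat.primesLE ⌊y⌋₊, ρ p / p ≤ Real.log (Real.log y) + Cf := by
    refine (hCf ⌊y⌋₊ hfl2).trans ?_
    have h1 : (2 : ℝ) ≤ ⌊y⌋₊ := by exact_mod_cast hfl2
    have h2 : (⌊y⌋₊ : ℝ) ≤ y := Nat.floor_le (by linarith)
    have := Real.log_le_log (Real.log_pos (by linarith)) (Real.log_le_log (by linarith) h2)
    linarith
  have hlogy : 0 < Real.log y := Real.log_pos hy1
  have hexp : Real.exp (K + ∑ p ∈ Nat.primesLE ⌊y⌋₊, ρ p / p) ≤ Real.exp (K + Cf) * Real.log y := by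
    calc Real.exp (K + ∑ p ∈ Nat.primesLE ⌊y⌋₊, ρ p / p)
        ≤ Real.exp (K + Cf + Real.log (Real.log y)) := Real.exp_le_exp.2 (by linarith)
      _ = Real.exp (K + Cf) * Real.log y := by rw [Real.exp_add, Real.exp_log hlogy]
  calc ∑ m ∈ Icc 1 ⌊y⌋₊, ρ m
      ≤ C₁ * (y / Real.log y) * Real.exp (K + ∑ p ∈ Nat.primesLE ⌊y⌋₊, ρ p / p) := hHT
    _ ≤ C₁ * (y / Real.log y) * (Real.exp (K + Cf) * Real.log y) :=
        mul_le_mul_of_nonneg_left hexp (by positivity)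
    _ = C₁ * Real.exp (K + Cf) * y := by field_simp

/-! ### Rankin's trick for the smooth numbers weighted by `ρ_f` (Hooley's Lemma 7 / `Σ₂`) -/

/-- Convexity: `p^η ≤ 1 + (e^t − 1) log p / log X` for `η = t / log X`, `t ≥ 0`, `1 ≤ p ≤ X`.
[folklore] -/
theorem rpow_div_log_le {t X p : ℝ} (ht : 0 ≤ t) (hX : 1 < X) (hp1 : 1 ≤ p) (hpX : p ≤ X) :
    p ^ (t / Real.log X) ≤ 1 + (Real.exp t - 1) * (Real.log p / Real.log X) := by
  have hlogX : 0 < Real.log X := Real.log_pos hX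
  have hlogp : 0 ≤ Real.log p := Real.log_nonneg hp1
  set s : ℝ := Real.log p / Real.log X with hs
  have hs0 : 0 ≤ s := div_nonneg hlogp hlogX.le
  have hs1 : s ≤ 1 := (div_le_one hlogX).2 (Real.log_le_log (by linarith) hpX)
  have hp0 : 0 < p := by linarith
  have e1 : p ^ (t / Real.log X) = Real.exp (s * t) := by
    rw [Real.rpow_def_of_pos hp0, hs]
    congr 1
    field_simp
  rw [e1]
  have hconv := convexOn_exp.2 (Set.mem_univ t) (Set.mem_univ (0 : ℝ)) hs0 (by linarith : 0 ≤ 1 - s)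
    (by ring)
  simp only [smul_eq_mul, mul_zero, add_zero, Real.exp_zero, mul_one] at hconv
  have _ := ht
  linarith

/-- The weighted prime sum of Rankin's method: for `t ≥ 0`, `X ≥ 2`,
`∑_{p ≤ X} p^{t/log X} / p ≤ log log X + 4 + 3 (e^t − 1)` (Mertens' bounds
`∑_{p ≤ X} 1/p ≤ log log X + 4`, `∑_{p ≤ X} log p / p ≤ log X + log 4`). [folklore] -/
theorem sum_primesLE_rpow_div_le {t X : ℝ} (ht : 0 ≤ t) (hX : 2 ≤ X) :
    ∑ p ∈ Nat.primesLE ⌊X⌋₊, (p : ℝ) ^ (t / Real.log X) / p ≤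
      Real.log (Real.log X) + 4 + 3 * (Real.exp t - 1) := by
  have hX1 : 1 < X := by linarith
  have hlogX : 0 < Real.log X := Real.log_pos hX1
  have hfl2 : 2 ≤ ⌊X⌋₊ := Nat.le_floor (by simpa using hX)
  have hflX : (⌊X⌋₊ : ℝ) ≤ X := Nat.floor_le (by linarith)
  have hfl0 : (0 : ℝ) < ⌊X⌋₊ := by exact_mod_cast (show 0 < ⌊X⌋₊ by omega)
  have het : 0 ≤ Real.exp t - 1 := by linarith [Real.add_one_le_exp t]
  have hterm : ∀ p ∈ Nat.primesLE ⌊X⌋₊, (p : ℝ) ^ (t / Real.log X) / p ≤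
      1 / p + (Real.exp t - 1) / Real.log X * (Real.log p / p) := by
    intro p hp
    have hp' := Nat.prime_of_mem_primesLE hp
    have hp0 : (0 : ℝ) < p := by exact_mod_cast hp'.pos
    have hp1 : (1 : ℝ) ≤ p := by exact_mod_cast hp'.one_lt.le
    have hpX : (p : ℝ) ≤ X := le_trans (by exact_mod_cast (Nat.mem_primesLE.1 hp).1) hflX
    have h := rpow_div_log_le ht hX1 hp1 hpX
    calc (p : ℝ) ^ (t / Real.log X) / p ≤ (1 + (Real.exp t - 1) * (Real.log p / Real.log X)) / p :=
          div_le_div_of_nonneg_right h hp0.le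
      _ = 1 / p + (Real.exp t - 1) / Real.log X * (Real.log p / p) := by
          field_simp
  refine (Finset.sum_le_sum hterm).trans ?_
  rw [Finset.sum_add_distrib, ← Finset.mul_sum]
  have h1 := LFunctions.MertensBound.sum_inv_prime_le ⌊X⌋₊ hfl2
  have h2 := LFunctions.MertensBound.sum_log_div_prime_le ⌊X⌋₊
  have h3 : Real.log (Real.log (⌊X⌋₊ : ℝ)) ≤ Real.log (Real.log X) := by
    have h1' : (2 : ℝ) ≤ ⌊X⌋₊ := by exact_mod_cast hfl2
    exact Real.log_le_log (Real.log_pos (by linarith)) (Real.log_le_log (by linarith) hflX)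
  have h4 : Real.log (⌊X⌋₊ : ℝ) + Real.log 4 ≤ 3 * Real.log X := by
    have : Real.log (⌊X⌋₊ : ℝ) ≤ Real.log X := Real.log_le_log hfl0 hflX
    have h4' : Real.log 4 ≤ 2 * Real.log X := by
      rw [show (4 : ℝ) = 2 ^ 2 by norm_num, Real.log_pow]
      push_cast
      linarith [Real.log_le_log (by norm_num : (0 : ℝ) < 2) hX]
    linarith
  have h5 : (Real.exp t - 1) / Real.log X * ∑ p ∈ Nat.primesLE ⌊X⌋₊, Real.log p / p ≤
      3 * (Real.exp t - 1) := by
    calc (Real.exp t - 1) / Real.log X * ∑ p ∈ Nat.primesLE ⌊X⌋₊, Real.log p / p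
        ≤ (Real.exp t - 1) / Real.log X * (3 * Real.log X) :=
          mul_le_mul_of_nonneg_left (h2.trans h4) (div_nonneg het hlogX.le)
      _ = 3 * (Real.exp t - 1) := by field_simp
  linarith

/-- **Rankin's trick for `∑ ρ_f(k₁) k₁^{η−1}` over the `X`-smooth numbers (Hooley's `Σ₂`,
his Lemma 7 in the numbering of Martin–Sitar 2011, §3.2).**  For `f` irreducible of positive degree
`n` there is `A = A(f) ∈ ℕ` such that for every `t ≥ 0` there is `C = C(f, t)` with: for all
`X ≥ 2` with `3t ≤ log X` and all `N`,
`∑_{k ≤ N, p ∣ k ⇒ p ≤ X} ρ_f(k) k^{t/log X − 1} ≤ C (log X)^A`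
(Euler product over the primes `p ≤ X`, `ρ_f(p^a) ≤ nM`, local factors `≤ exp(3nM p^η/p)`,
and `sum_primesLE_rpow_div_le`; `A = 3nM`).  With `X = x^{1/v}` and `k > x^{1/3}` this gives
Hooley's bound `∑_{k₁ > x^{1/3}} ρ(k₁)/k₁ ≤ C e^{−tv/3} (log x)^A`. [cite: Hooley1964, Lemma 7
(per MartinSitar2010 §3.2)] -/
theorem exists_sum_rootCount_smooth_rpow_le {f : ℤ[X]} (hirr : Irreducible f)
    (hdeg : 0 < f.natDegree) :
    ∃ A : ℕ, ∀ t : ℝ, 0 ≤ t → ∃ C : ℝ, 0 < C ∧ ∀ X : ℝ, 2 ≤ X → 3 * t ≤ Real.log X → ∀ N : ℕ,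
      ∑ k ∈ (Icc 1 N).filter (fun k : ℕ => ∀ p ∈ k.primeFactors, (p : ℝ) ≤ X),
        (polyRootCountMod ![f] k : ℝ) * (k : ℝ) ^ (t / Real.log X - 1) ≤ C * Real.log X ^ A := by
  obtain ⟨M, hM1, hM, -⟩ := exists_rootCount_primePow_le hirr hdeg
  set n := f.natDegree with hn
  set L : ℝ := ((n * M : ℕ) : ℝ) with hL
  have hL1 : (1 : ℝ) ≤ L := by rw [hL]; exact_mod_cast Nat.mul_le_mul hdeg hM1
  have hL0 : 0 ≤ L := by linarith
  refine ⟨3 * (n * M), fun t ht => ⟨Real.exp (3 * L * (4 + 3 * (Real.exp t - 1))), Real.exp_pos _,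
    fun X hX htX N => ?_⟩⟩
  have hX1 : 1 < X := by linarith
  have hlogX : 0 < Real.log X := Real.log_pos hX1
  set η : ℝ := t / Real.log X with hη
  have hη0 : 0 ≤ η := div_nonneg ht hlogX.le
  have hη3 : η ≤ 1 / 3 := by
    rw [hη, div_le_iff₀ hlogX]; linarith
  set ρ : ℕ → ℝ := fun m => (polyRootCountMod ![f] m : ℝ) with hρ
  -- the multiplicative function `F(k) = ρ(k) k^η 1_{X-smooth}(k)`
  set F : ℕ → ℝ := fun k => if ∀ p ∈ k.primeFactors, (p : ℝ) ≤ X then ρ k * (k : ℝ) ^ η else 0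
    with hF
  have hF1 : F 1 = 1 := by simp [hF, hρ, (show polyRootCountMod ![f] 1 = 1 by rw [polyRootCountMod_single]; simp)]
  have hF0 : ∀ k, 0 ≤ F k := fun k => by
    simp only [hF]; split_ifs <;> positivity
  have hFmul : ∀ a b, Nat.Coprime a b → F (a * b) = F a * F b := by
    intro a b hab
    have hiff : (∀ p ∈ (a * b).primeFactors, (p : ℝ) ≤ X) ↔
        (∀ p ∈ a.primeFactors, (p : ℝ) ≤ X) ∧ ∀ p ∈ b.primeFactors, (p : ℝ) ≤ X := by
      rw [Nat.Coprime.primeFactors_mul hab, Finset.forall_mem_union]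
    simp only [hF]
    by_cases ha : ∀ p ∈ a.primeFactors, (p : ℝ) ≤ X
    · by_cases hb : ∀ p ∈ b.primeFactors, (p : ℝ) ≤ X
      · rw [if_pos (hiff.2 ⟨ha, hb⟩), if_pos ha, if_pos hb, hρ]
        dsimp only
        rw [polyRootCountMod_mul_of_coprime f hab, Nat.cast_mul, Nat.cast_mul,
          Real.mul_rpow (Nat.cast_nonneg a) (Nat.cast_nonneg b)]
        ring
      · rw [if_neg (fun h => hb (hiff.1 h).2), if_neg hb, mul_zero]
    · rw [if_neg (fun h => ha (hiff.1 h).1), if_neg ha, zero_mul]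
  -- local bound `F(p^ν)/p^ν ≤ L r_p^ν`, `r_p = p^{η-1} ≤ 2^{-2/3}`
  have hloc : ∀ p : ℕ, p.Prime → ∀ ν : ℕ, F (p ^ ν) / (p : ℝ) ^ ν ≤ L * ((p : ℝ) ^ (η - 1)) ^ ν := by
    intro p hp ν
    have hp0 : (0 : ℝ) < p := by exact_mod_cast hp.pos
    have hpow : (0 : ℝ) < (p : ℝ) ^ ν := by positivity
    rw [div_le_iff₀ hpow]
    have e1 : ((p : ℝ) ^ (η - 1)) ^ ν * (p : ℝ) ^ ν = ((p ^ ν : ℕ) : ℝ) ^ η := by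
      rw [← Real.rpow_natCast ((p : ℝ) ^ (η - 1)) ν, ← Real.rpow_mul hp0.le, Nat.cast_pow,
        ← Real.rpow_natCast (p : ℝ) ν, ← Real.rpow_mul hp0.le, ← Real.rpow_add hp0]
      congr 1; ring
    rw [mul_assoc, e1]
    simp only [hF]
    split_ifs
    · refine mul_le_mul_of_nonneg_right ?_ (by positivity)
      simp only [hρ, hL]; exact_mod_cast hM p hp ν
    · positivity
  have hr : ∀ p : ℕ, p.Prime → 0 ≤ (p : ℝ) ^ (η - 1) ∧ (p : ℝ) ^ (η - 1) ≤ 2 / 3 := by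
    intro p hp
    have hp2 : (2 : ℝ) ≤ p := by exact_mod_cast hp.two_le
    have hp0 : (0 : ℝ) < p := by linarith
    refine ⟨by positivity, ?_⟩
    calc (p : ℝ) ^ (η - 1) ≤ (p : ℝ) ^ (-(2 / 3) : ℝ) :=
          Real.rpow_le_rpow_of_exponent_le (by linarith) (by linarith)
      _ ≤ (2 : ℝ) ^ (-(2 / 3) : ℝ) :=
          Real.rpow_le_rpow_of_nonpos (by norm_num) hp2 (by norm_num)
      _ ≤ 2 / 3 := by
          -- `2^{-2/3} ≤ 2/3` iff `27/8 ≤ 4`: compare cubes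
          have h8 : ((2 : ℝ) ^ (-(2 / 3) : ℝ)) ^ (3 : ℕ) = 1 / 4 := by
            rw [← Real.rpow_natCast, ← Real.rpow_mul (by norm_num)]; norm_num
          have h0 : (0 : ℝ) ≤ (2 : ℝ) ^ (-(2 / 3) : ℝ) := by positivity
          nlinarith [h8, sq_nonneg ((2 : ℝ) ^ (-(2 / 3) : ℝ) - 2 / 3),
            sq_nonneg ((2 : ℝ) ^ (-(2 / 3) : ℝ))]
  have hsumm : ∀ p : ℕ, p.Prime → Summable (fun ν : ℕ => F (p ^ ν) / (p : ℝ) ^ ν) := by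
    intro p hp
    obtain ⟨hr0, hr1⟩ := hr p hp
    refine Summable.of_nonneg_of_le (fun ν => div_nonneg (hF0 _) (by positivity)) (hloc p hp)
      ((summable_geometric_of_lt_one hr0 (by linarith)).mul_left L)
  -- local factor bounds
  have hfac : ∀ p : ℕ, p.Prime → ∑' ν : ℕ, F (p ^ ν) / (p : ℝ) ^ ν ≤
      Real.exp (if (p : ℝ) ≤ X then 3 * L * ((p : ℝ) ^ η / p) else 0) := by
    intro p hp
    have hp0 : (0 : ℝ) < p := by exact_mod_cast hp.pos
    obtain ⟨hr0, hr1⟩ := hr p hp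
    have hs := hsumm p hp
    rw [hs.tsum_eq_zero_add]
    simp only [pow_zero, hF1, div_one]
    split_ifs with hpX
    · -- `∑_{ν ≥ 1} ≤ L r/(1-r) ≤ 3 L r`, `r = p^η / p`
      set r := (p : ℝ) ^ (η - 1) with hrdef
      have hr_eq : r = (p : ℝ) ^ η / p := by
        rw [hrdef, Real.rpow_sub_one hp0.ne']
      have htail : ∑' ν : ℕ, F (p ^ (ν + 1)) / (p : ℝ) ^ (ν + 1) ≤ L * r * (1 - r)⁻¹ := by
        have hle : ∀ ν : ℕ, F (p ^ (ν + 1)) / (p : ℝ) ^ (ν + 1) ≤ L * r * r ^ ν := fun ν => by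
          calc _ ≤ L * r ^ (ν + 1) := hloc p hp (ν + 1)
            _ = L * r * r ^ ν := by ring
        calc _ ≤ ∑' ν : ℕ, L * r * r ^ ν :=
              ((summable_nat_add_iff 1).mpr hs).tsum_le_tsum hle
                ((summable_geometric_of_lt_one hr0 (by linarith)).mul_left _)
          _ = L * r * (1 - r)⁻¹ := by
              rw [tsum_mul_left, tsum_geometric_of_lt_one hr0 (by linarith)]
      have hinv : (1 - r)⁻¹ ≤ 3 := by
        rw [inv_le_comm₀ (by linarith) (by norm_num)]; linarith
      have h3 : L * r * (1 - r)⁻¹ ≤ 3 * L * r := by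
        have : 0 ≤ L * r := mul_nonneg hL0 hr0
        nlinarith
      rw [← hr_eq]
      linarith [Real.add_one_le_exp (3 * L * r)]
    · -- `p > X`: all terms with `ν ≥ 1` vanish
      have hzero : ∀ ν : ℕ, F (p ^ (ν + 1)) / (p : ℝ) ^ (ν + 1) = 0 := by
        intro ν
        have hpf : (p ^ (ν + 1)).primeFactors = {p} := Nat.primeFactors_prime_pow (by omega) hp
        simp only [hF, hpf, Finset.mem_singleton, forall_eq, if_neg hpX, zero_div]
      rw [tsum_congr hzero, tsum_zero, add_zero, Real.exp_zero]
  -- (0.4)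
  have h04 := LFunctions.HallTenenbaum.sum_div_le_prod_tsum hF1 hFmul hF0 hsumm N
  have hLHS : ∑ k ∈ (Icc 1 N).filter (fun k : ℕ => ∀ p ∈ k.primeFactors, (p : ℝ) ≤ X),
      ρ k * (k : ℝ) ^ (η - 1) = ∑ k ∈ Icc 1 N, F k / k := by
    rw [Finset.sum_filter]
    refine Finset.sum_congr rfl fun k hk => ?_
    have hk0 : (k : ℝ) ≠ 0 := by exact_mod_cast (show k ≠ 0 by have := (Finset.mem_Icc.1 hk).1; omega)
    simp only [hF]
    split_ifs
    · rw [Real.rpow_sub_one hk0, mul_div_assoc]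
    · rw [zero_div]
  rw [hLHS]
  refine h04.trans ?_
  -- product of local factors ≤ exp (3 L ∑_{p ≤ X} p^η/p)
  have hprod : ∏ p ∈ Nat.primesLE N, ∑' ν : ℕ, F (p ^ ν) / (p : ℝ) ^ ν ≤
      Real.exp (3 * L * ∑ p ∈ Nat.primesLE ⌊X⌋₊, (p : ℝ) ^ η / p) := by
    calc ∏ p ∈ Nat.primesLE N, ∑' ν : ℕ, F (p ^ ν) / (p : ℝ) ^ ν
        ≤ ∏ p ∈ Nat.primesLE N, Real.exp (if (p : ℝ) ≤ X then 3 * L * ((p : ℝ) ^ η / p) else 0) :=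
          Finset.prod_le_prod (fun p _ => tsum_nonneg fun ν => div_nonneg (hF0 _) (by positivity))
            fun p hp => hfac p (Nat.prime_of_mem_primesLE hp)
      _ = Real.exp (∑ p ∈ Nat.primesLE N, if (p : ℝ) ≤ X then 3 * L * ((p : ℝ) ^ η / p) else 0) := by
          rw [Real.exp_sum]
      _ ≤ Real.exp (3 * L * ∑ p ∈ Nat.primesLE ⌊X⌋₊, (p : ℝ) ^ η / p) := by
          rw [Real.exp_le_exp, ← Finset.sum_filter, Finset.mul_sum]
          refine Finset.sum_le_sum_of_subset_of_nonneg (fun p hp => ?_) (fun p _ _ => ?_)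
          · rw [Finset.mem_filter, Nat.mem_primesLE] at hp
            exact Nat.mem_primesLE.2 ⟨Nat.le_floor hp.2, hp.1.2⟩
          · have : (0 : ℝ) ≤ p := Nat.cast_nonneg p
            positivity
  refine hprod.trans ?_
  have hps := sum_primesLE_rpow_div_le ht hX
  rw [← hη] at hps
  calc Real.exp (3 * L * ∑ p ∈ Nat.primesLE ⌊X⌋₊, (p : ℝ) ^ η / p)
      ≤ Real.exp (3 * L * (Real.log (Real.log X) + 4 + 3 * (Real.exp t - 1))) :=
        Real.exp_le_exp.2 (mul_le_mul_of_nonneg_left hps (by positivity))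
    _ = Real.exp (3 * L * (4 + 3 * (Real.exp t - 1))) * Real.log X ^ (3 * (n * M)) := by
        rw [show 3 * L * (Real.log (Real.log X) + 4 + 3 * (Real.exp t - 1)) =
          3 * L * (4 + 3 * (Real.exp t - 1)) + (3 * (n * M) : ℕ) * Real.log (Real.log X) by
            rw [hL]; push_cast; ring]
        rw [Real.exp_add, Real.exp_nat_mul, Real.exp_log hlogX]

/-! ### The sum of Hooley's multiplicative function `G` (end of the estimation of `Σ₁`) -/

/-- **`∑_{k ≤ N} √((h,k) ρ_f(k) / (k φ(k))) ≤ C (log N)^{1 − δ_n}`** for `f` irreducible of degree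
`n ≥ 2`, `h ≠ 0`, `N ≥ 2` (Martin–Sitar 2011, §3.2, last display, with Hooley's exponent: the
Euler product of the multiplicative function `G(k) = ((h,k) ρ_f(k)/(k φ(k)))^{1/2}` is
`≪ exp(∑_{p ≤ N} √ρ_f(p)/p)`, and `sum_sqrt_polyRootCountMod_div_le` bounds the exponent by
`(1 − δ_n) log log N + O(1)`). [cite: MartinSitar2010, §3.2 (last display: the sum over k₁ of Hooley's proof)] -/
theorem exists_sum_sqrt_gcd_rootCount_div_le {f : ℤ[X]} (hirr : Irreducible f)
    (hn : 2 ≤ f.natDegree) {h : ℤ} (hh : h ≠ 0) :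
    ∃ C : ℝ, 0 < C ∧ ∀ N : ℕ, 2 ≤ N →
      ∑ k ∈ Icc 1 N, Real.sqrt ((Int.gcd h k : ℝ) * polyRootCountMod ![f] k / ((k : ℝ) * φ k)) ≤
        C * Real.log N ^ (1 - hooleyDelta f.natDegree) := by
  have hdeg : 0 < f.natDegree := by omega
  obtain ⟨M, hM1, hM, hρp⟩ := exists_rootCount_primePow_le hirr hdeg
  obtain ⟨Cd, hCd⟩ := sum_sqrt_polyRootCountMod_div_le hirr hn
  set n := f.natDegree with hndef
  set H : ℕ := h.natAbs with hH
  have hH0 : 0 < H := Int.natAbs_pos.2 hh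
  set L : ℝ := Real.sqrt (2 * H * (n * M : ℕ)) with hL
  have hL0 : 0 ≤ L := Real.sqrt_nonneg _
  -- constants
  set E : ℝ := (n : ℝ) + L + (H : ℝ) * ((H : ℝ) * n) with hE
  refine ⟨Real.exp (E + Cd), Real.exp_pos _, fun N hN => ?_⟩
  set ρ : ℕ → ℝ := fun m => (polyRootCountMod ![f] m : ℝ) with hρ
  set G : ℕ → ℝ := fun k => Real.sqrt ((Int.gcd h k : ℝ) * ρ k / ((k : ℝ) * φ k)) with hG
  -- `F = k G(k)` is multiplicative
  set F : ℕ → ℝ := fun k => (k : ℝ) * G k with hF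
  have hgcd : ∀ k : ℕ, (Int.gcd h k : ℝ) = (Nat.gcd H k : ℝ) := fun k => by
    rw [hH, Int.gcd, Int.natAbs_natCast]
  have hG0 : ∀ k, 0 ≤ G k := fun k => Real.sqrt_nonneg _
  have hF0 : ∀ k, 0 ≤ F k := fun k => mul_nonneg (Nat.cast_nonneg k) (hG0 k)
  have hF1 : F 1 = 1 := by simp [hF, hG, hρ, (show polyRootCountMod ![f] 1 = 1 by rw [polyRootCountMod_single]; simp)]
  have hGmul : ∀ a b, Nat.Coprime a b → G (a * b) = G a * G b := by
    intro a b hab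
    simp only [hG, hρ, hgcd, Nat.Coprime.gcd_mul H hab, polyRootCountMod_mul_of_coprime f hab,
      Nat.totient_mul hab, Nat.cast_mul]
    rw [← Real.sqrt_mul (by positivity)]
    congr 1
    rcases eq_or_ne a 0 with rfl | ha
    · simp [(show polyRootCountMod ![f] 0 = 0 by rw [polyRootCountMod_single]; simp)]
    rcases eq_or_ne b 0 with rfl | hb
    · simp [(show polyRootCountMod ![f] 0 = 0 by rw [polyRootCountMod_single]; simp)]
    have ha' : (a : ℝ) * φ a ≠ 0 := by
      have := Nat.totient_pos.2 (Nat.pos_of_ne_zero ha); positivity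
    have hb' : (b : ℝ) * φ b ≠ 0 := by
      have := Nat.totient_pos.2 (Nat.pos_of_ne_zero hb); positivity
    field_simp
  have hFmul : ∀ a b, Nat.Coprime a b → F (a * b) = F a * F b := by
    intro a b hab
    simp only [hF]
    rw [hGmul a b hab, Nat.cast_mul]; ring
  -- `G(p^a) ≤ L / p^a` for `a ≥ 1`
  have hGpow : ∀ p : ℕ, p.Prime → ∀ a : ℕ, 1 ≤ a → G (p ^ a) ≤ L * (1 / (p : ℝ)) ^ a := by
    intro p hp a ha
    have hp2 : (2 : ℝ) ≤ p := by exact_mod_cast hp.two_le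
    have hp0 : (0 : ℝ) < p := by linarith
    have hpa : (0 : ℝ) < (p : ℝ) ^ a := by positivity
    obtain ⟨a', rfl⟩ : ∃ a', a = a' + 1 := ⟨a - 1, by omega⟩
    have hφ : (φ (p ^ (a' + 1)) : ℝ) = (p : ℝ) ^ a' * (p - 1) := by
      rw [Nat.totient_prime_pow_succ hp]
      have : 1 ≤ p := hp.one_lt.le
      push_cast [Nat.cast_sub this]
      ring
    simp only [hG]
    rw [div_pow, one_pow, mul_one_div, Real.sqrt_le_left (by positivity)]
    -- `gcd · ρ / (p^a φ) ≤ L² / p^{2a}`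
    have hgcdle : (Int.gcd h (p ^ (a' + 1) : ℕ) : ℝ) ≤ H := by
      rw [hgcd]; exact_mod_cast Nat.gcd_le_left _ hH0
    have hρle : ρ (p ^ (a' + 1)) ≤ ((n * M : ℕ) : ℝ) := by
      simp only [hρ]; exact_mod_cast hM p hp (a' + 1)
    have hden : (p : ℝ) ^ (a' + 1) * (p : ℝ) ^ (a' + 1) ≤ 2 * ((p : ℝ) ^ (a' + 1) * ((p : ℝ) ^ a' * (p - 1))) := by
      have : (p : ℝ) ≤ 2 * (p - 1) := by linarith
      have hpa' : (0 : ℝ) ≤ (p : ℝ) ^ a' := by positivity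
      calc (p : ℝ) ^ (a' + 1) * (p : ℝ) ^ (a' + 1) = (p : ℝ) ^ (a' + 1) * ((p : ℝ) ^ a' * p) := by ring
        _ ≤ (p : ℝ) ^ (a' + 1) * ((p : ℝ) ^ a' * (2 * (p - 1))) := by gcongr
        _ = _ := by ring
    have hp1 : (0 : ℝ) < (p : ℝ) - 1 := by linarith
    have hD : (0 : ℝ) < (p : ℝ) ^ (a' + 1) * ((p : ℝ) ^ a' * (p - 1)) := by positivity
    have hcast : ((p ^ (a' + 1) : ℕ) : ℝ) = (p : ℝ) ^ (a' + 1) := by norm_cast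
    rw [hcast, hφ, div_le_iff₀ hD]
    have hnum : (Int.gcd h (p ^ (a' + 1) : ℕ) : ℝ) * ρ (p ^ (a' + 1)) ≤ L ^ 2 / 2 := by
      calc (Int.gcd h (p ^ (a' + 1) : ℕ) : ℝ) * ρ (p ^ (a' + 1))
          ≤ H * ((n * M : ℕ) : ℝ) := mul_le_mul hgcdle hρle (Nat.cast_nonneg _) (Nat.cast_nonneg _)
        _ = L ^ 2 / 2 := by
            rw [hL, Real.sq_sqrt (by positivity)]; ring
    have hkey : L ^ 2 / 2 ≤ (L / (p : ℝ) ^ (a' + 1)) ^ 2 * ((p : ℝ) ^ (a' + 1) * ((p : ℝ) ^ a' * (p - 1))) := by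
      rw [div_pow, div_mul_eq_mul_div, le_div_iff₀ (by positivity)]
      have hL2 : 0 ≤ L ^ 2 := sq_nonneg L
      calc L ^ 2 / 2 * ((p : ℝ) ^ (a' + 1)) ^ 2 = L ^ 2 / 2 * ((p : ℝ) ^ (a' + 1) * (p : ℝ) ^ (a' + 1)) := by ring
        _ ≤ L ^ 2 / 2 * (2 * ((p : ℝ) ^ (a' + 1) * ((p : ℝ) ^ a' * (p - 1)))) :=
            mul_le_mul_of_nonneg_left hden (by positivity)
        _ = L ^ 2 * ((p : ℝ) ^ (a' + 1) * ((p : ℝ) ^ a' * (p - 1))) := by ring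
    exact hnum.trans hkey
  -- summability of the local factors of `F`
  have hsumm : ∀ p : ℕ, p.Prime → Summable (fun ν : ℕ => F (p ^ ν) / (p : ℝ) ^ ν) := by
    intro p hp
    have hp0 : (0 : ℝ) < p := by exact_mod_cast hp.pos
    have hr0 : (0 : ℝ) ≤ 1 / p := by positivity
    have hr1 : (1 : ℝ) / p < 1 := by
      rw [div_lt_one hp0]; exact_mod_cast hp.one_lt
    have heq : ∀ ν : ℕ, F (p ^ ν) / (p : ℝ) ^ ν = G (p ^ ν) := fun ν => by
      simp only [hF]; rw [Nat.cast_pow, mul_div_cancel_left₀ _ (by positivity)]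
    simp_rw [heq]
    refine Summable.of_nonneg_of_le (fun ν => hG0 _) (fun ν => ?_)
      (((summable_geometric_of_lt_one hr0 hr1).mul_left (max L 1)))
    rcases Nat.eq_zero_or_pos ν with rfl | hν
    · simp only [pow_zero, mul_one]
      have : G 1 = 1 := by simp [hG, hρ, (show polyRootCountMod ![f] 1 = 1 by rw [polyRootCountMod_single]; simp)]
      rw [this]; exact le_max_right _ _
    · exact (hGpow p hp ν hν).trans (mul_le_mul_of_nonneg_right (le_max_left _ _) (by positivity))
  -- the local factor at `p`: `≤ exp (u_p)`
  set u : ℕ → ℝ := fun p => Real.sqrt (ρ p) / p + ((n : ℝ) + L) * (1 / ((p : ℝ) * (p - 1))) +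
    (if p ∣ H then (H : ℝ) * n else 0) with hu
  have hfac : ∀ p : ℕ, p.Prime → ∑' ν : ℕ, F (p ^ ν) / (p : ℝ) ^ ν ≤ Real.exp (u p) := by
    intro p hp
    have hp2 : (2 : ℝ) ≤ p := by exact_mod_cast hp.two_le
    have hp0 : (0 : ℝ) < p := by linarith
    have hp1 : (0 : ℝ) < p - 1 := by linarith
    have hs := hsumm p hp
    have heq : ∀ ν : ℕ, F (p ^ ν) / (p : ℝ) ^ ν = G (p ^ ν) := fun ν => by
      simp only [hF]; rw [Nat.cast_pow, mul_div_cancel_left₀ _ (by positivity)]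
    rw [hs.tsum_eq_zero_add, ((summable_nat_add_iff 1).mpr hs).tsum_eq_zero_add]
    simp only [pow_zero, hF1, div_one, zero_add]
    simp_rw [heq]
    rw [pow_one]
    -- tail `∑_{ν ≥ 2} G(p^ν) ≤ L ∑_{ν≥2} p^{-ν} = L/(p(p-1))`
    have hr0 : (0 : ℝ) ≤ 1 / p := by positivity
    have hr1 : (1 : ℝ) / p < 1 := by rw [div_lt_one hp0]; linarith
    have htail : ∑' ν : ℕ, G (p ^ (ν + 1 + 1)) ≤ L * (1 / ((p : ℝ) * (p - 1))) := by
      have hle : ∀ ν : ℕ, G (p ^ (ν + 1 + 1)) ≤ L * (1 / (p : ℝ)) ^ 2 * (1 / (p : ℝ)) ^ ν := fun ν => by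
        calc _ ≤ L * (1 / (p : ℝ)) ^ (ν + 1 + 1) := hGpow p hp _ (by omega)
          _ = _ := by ring
      have hs2 : Summable (fun ν : ℕ => G (p ^ (ν + 1 + 1))) := by
        have := (summable_nat_add_iff 2).mpr (hs.congr heq)
        simpa using this
      calc ∑' ν : ℕ, G (p ^ (ν + 1 + 1)) ≤ ∑' ν : ℕ, L * (1 / (p : ℝ)) ^ 2 * (1 / (p : ℝ)) ^ ν :=
            hs2.tsum_le_tsum hle ((summable_geometric_of_lt_one hr0 hr1).mul_left _)
        _ = L * (1 / (p : ℝ)) ^ 2 * (1 - 1 / (p : ℝ))⁻¹ := by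
            rw [tsum_mul_left, tsum_geometric_of_lt_one hr0 hr1]
        _ = L * (1 / ((p : ℝ) * (p - 1))) := by
            have hp1' : (p : ℝ) - 1 ≠ 0 := hp1.ne'
            have e1 : (1 : ℝ) - 1 / p = (p - 1) / p := by field_simp
            rw [e1, inv_div]
            field_simp
    -- `G(p) ≤ √ρ(p)/p + n/(p(p-1)) + [p ∣ H] H n`
    have hGp : G p ≤ Real.sqrt (ρ p) / p + (n : ℝ) * (1 / ((p : ℝ) * (p - 1))) +
        (if p ∣ H then (H : ℝ) * n else 0) := by
      have hρn : ρ p ≤ n := by simp only [hρ]; exact_mod_cast hρp p hp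
      have hρ0 : 0 ≤ ρ p := Nat.cast_nonneg _
      have hsρ : Real.sqrt (ρ p) ≤ n := by
        rw [Real.sqrt_le_left (Nat.cast_nonneg _)]
        have hn1 : (1 : ℝ) ≤ n := by exact_mod_cast hdeg
        nlinarith
      have hφp : (φ p : ℝ) = p - 1 := by
        rw [Nat.totient_prime hp]; push_cast [Nat.cast_sub hp.one_lt.le]; ring
      simp only [hG]
      rw [hφp]
      split_ifs with hpH
      · -- `p ∣ H`: crude bound `G(p) ≤ √(H n) ≤ H n`
        have hg : (Int.gcd h p : ℝ) ≤ H := by rw [hgcd]; exact_mod_cast Nat.gcd_le_left _ hH0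
        have h1 : (Int.gcd h p : ℝ) * ρ p / ((p : ℝ) * (p - 1)) ≤ (H : ℝ) * n := by
          rw [div_le_iff₀ (by positivity)]
          have hH1 : (1 : ℝ) ≤ H := by exact_mod_cast hH0
          have : (1 : ℝ) ≤ (p : ℝ) * (p - 1) := by nlinarith
          calc (Int.gcd h p : ℝ) * ρ p ≤ H * n := mul_le_mul hg hρn hρ0 (Nat.cast_nonneg _)
            _ ≤ H * n * ((p : ℝ) * (p - 1)) := le_mul_of_one_le_right (by positivity) this
        have h2 : Real.sqrt ((Int.gcd h p : ℝ) * ρ p / ((p : ℝ) * (p - 1))) ≤ (H : ℝ) * n := by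
          rw [Real.sqrt_le_left (by positivity)]
          have hHn1 : (1 : ℝ) ≤ (H : ℝ) * n := by
            have hH1 : (1 : ℝ) ≤ H := by exact_mod_cast hH0
            have hn1 : (1 : ℝ) ≤ n := by exact_mod_cast hdeg
            nlinarith
          nlinarith
        have : 0 ≤ Real.sqrt (ρ p) / p + (n : ℝ) * (1 / ((p : ℝ) * (p - 1))) := by positivity
        linarith
      · -- `p ∤ H`: `gcd = 1`, `G(p) = √ρ(p) / √(p(p-1)) ≤ √ρ(p) (1/p + 1/(p(p-1)))`
        have hg : (Int.gcd h p : ℝ) = 1 := by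
          rw [hgcd]
          have : Nat.Coprime H p := (Nat.Prime.coprime_iff_not_dvd hp).2 hpH |>.symm
          exact_mod_cast this
        rw [hg, one_mul, Real.sqrt_div' _ (mul_nonneg hp0.le hp1.le), add_zero]
        have hsq : 1 / Real.sqrt ((p : ℝ) * (p - 1)) ≤ 1 / (p - 1) := by
          rw [div_le_div_iff_of_pos_left one_pos (Real.sqrt_pos.2 (mul_pos hp0 hp1)) hp1]
          rw [Real.le_sqrt' hp1]
          nlinarith
        have e1 : (1 : ℝ) / (p - 1) = 1 / p + 1 / ((p : ℝ) * (p - 1)) := by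
          field_simp; ring
        calc Real.sqrt (ρ p) / Real.sqrt ((p : ℝ) * (p - 1))
            = Real.sqrt (ρ p) * (1 / Real.sqrt ((p : ℝ) * (p - 1))) := by ring
          _ ≤ Real.sqrt (ρ p) * (1 / p + 1 / ((p : ℝ) * (p - 1))) := by
              rw [← e1]; exact mul_le_mul_of_nonneg_left hsq (Real.sqrt_nonneg _)
          _ = Real.sqrt (ρ p) / p + Real.sqrt (ρ p) * (1 / ((p : ℝ) * (p - 1))) := by ring
          _ ≤ Real.sqrt (ρ p) / p + (n : ℝ) * (1 / ((p : ℝ) * (p - 1))) := by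
              gcongr
    have hkey : G p + ∑' ν : ℕ, G (p ^ (ν + 1 + 1)) ≤ u p := by
      rw [hu]
      simp only
      nlinarith [hGp, htail]
    linarith [hkey, Real.add_one_le_exp (u p), hG0 p]
  -- (0.4) and the prime sum
  have h04 := LFunctions.HallTenenbaum.sum_div_le_prod_tsum hF1 hFmul hF0 hsumm N
  have hLHS : ∑ k ∈ Icc 1 N, G k = ∑ k ∈ Icc 1 N, F k / k := by
    refine Finset.sum_congr rfl fun k hk => ?_
    have hk0 : (k : ℝ) ≠ 0 := by exact_mod_cast (show k ≠ 0 by have := (Finset.mem_Icc.1 hk).1; omega)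
    simp only [hF]; rw [mul_div_cancel_left₀ _ hk0]
  rw [hLHS]
  refine h04.trans ?_
  have hprod : ∏ p ∈ Nat.primesLE N, ∑' ν : ℕ, F (p ^ ν) / (p : ℝ) ^ ν ≤
      Real.exp (∑ p ∈ Nat.primesLE N, u p) := by
    rw [Real.exp_sum]
    exact Finset.prod_le_prod (fun p _ => tsum_nonneg fun ν => div_nonneg (hF0 _) (by positivity))
      fun p hp => hfac p (Nat.prime_of_mem_primesLE hp)
  refine hprod.trans ?_
  -- `∑_{p ≤ N} u_p ≤ (1 - δ) log log N + Cd + E`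
  have hu_sum : ∑ p ∈ Nat.primesLE N, u p ≤
      (1 - hooleyDelta n) * Real.log (Real.log N) + Cd + E := by
    simp only [hu]
    rw [Finset.sum_add_distrib, Finset.sum_add_distrib, ← Finset.mul_sum]
    have h1 := hCd N hN
    have h2 := LFunctions.MertensBound.sum_inv_prime_mul_pred_le_one N
    have h3 : ∑ p ∈ Nat.primesLE N, (if p ∣ H then (H : ℝ) * n else 0) ≤ (H : ℝ) * ((H : ℝ) * n) := by
      rw [← Finset.sum_filter]
      calc ∑ p ∈ (Nat.primesLE N).filter (fun p => p ∣ H), (H : ℝ) * n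
          = #((Nat.primesLE N).filter (fun p => p ∣ H)) * ((H : ℝ) * n) := by
            rw [Finset.sum_const, nsmul_eq_mul]
        _ ≤ (H : ℝ) * ((H : ℝ) * n) := by
            refine mul_le_mul_of_nonneg_right ?_ (by positivity)
            have : #((Nat.primesLE N).filter (fun p => p ∣ H)) ≤ #(Icc 1 H) := by
              refine Finset.card_le_card fun p hp => ?_
              rw [Finset.mem_filter, Nat.mem_primesLE] at hp
              rw [Finset.mem_Icc]
              exact ⟨hp.1.2.pos, Nat.le_of_dvd hH0 hp.2⟩
            rw [Nat.card_Icc, Nat.add_sub_cancel] at this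
            exact_mod_cast this
    have hnL : 0 ≤ (n : ℝ) + L := by positivity
    have h2' := mul_le_mul_of_nonneg_left h2 hnL
    rw [hE]
    have hρeq : ∑ p ∈ Nat.primesLE N, Real.sqrt (ρ p) / p =
        ∑ p ∈ Nat.primesLE N, Real.sqrt (polyRootCountMod ![f] p) / p := rfl
    linarith
  have hlogN : 0 < Real.log N := Real.log_pos (by exact_mod_cast hN)
  calc Real.exp (∑ p ∈ Nat.primesLE N, u p)
      ≤ Real.exp ((1 - hooleyDelta n) * Real.log (Real.log N) + Cd + E) := Real.exp_le_exp.2 hu_sum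
    _ = Real.exp (E + Cd) * Real.log N ^ (1 - hooleyDelta n) := by
        rw [Real.rpow_def_of_pos hlogN, ← Real.exp_add]
        congr 1; ring

end Literature.NumberTheory.Sieve
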